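import Mathlib
import Summits.Ventures.HodgeRepro.Tier4.Line1.RotationGram
import Summits.Ventures.HodgeRepro.Tier4.Line1.StabLine

/-!
# Tier4/Line1/TorusBlockScalar — an `Ω`-linear isometry preserving two orthogonal `E′`-lines is a pair of norm-one
scalars (the TORUS twin of `Rot.stab_scalar_of_isometry`)

Blind re-derivation cell `pub-hodge-repro`, Tier 4 (README §9–§10), seat t4-L1-p5 (prover, LINE L1, gen 2).
Generic linear algebra over a commutative `k`-algebra `R` through `ι : k →+* R` (`k` a field of characteristic `0`),
column picture, the set-up of t4-L1-p3's `stab_scalar_of_isometry` (`Tier4/Line1/StabLine.lean`, with attribution —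
the adapted basis `S = (v, Om v, w, Om w)`, its Gram matrix `diag(α, dα, α′, dα′)` and `Om = S diag(J, J) S⁻¹` are
`Rot.gram_adapted` / `Rot.mul_adapted_eq`): if `M` over `R` commutes with `Om`, is a `B`-isometry, and commutes with
the rational projector `P` onto the line of `v` along the line of `w` (`P v = v`, `P (Om v) = Om v`, `P w = 0`,
`P (Om w) = 0`), then `N = S⁻¹ M S` is block-diagonal (it commutes with `diag(1, 1, 0, 0)`), each block commutes
with `J` (so is `[[x, −d y], [y, x]]`) and is an isometry of `diag(α, dα)` (so `x² + d y² = 1`):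
`M = S · blockScalar d x y x′ y′ · S⁻¹` (`torus_scalar_of_isometry`).  Conversely every such block-scalar matrix is an
`Om`-linear `B`-isometry commuting with `P` (`blockScalar_*`), and the block scalars multiply like
`k(√−d)² ∋ (x + y√−d, x′ + y′√−d)`.  This is the linear algebra of the torus bridge (I1-c′)/(I1-c″) ⇐ hstab rung (ii)
(CENSUS v7 row V15, `proofs/t4/L1/I1-c-CENSUS.md` §7).  Mathlib + the line's landed modules only; no printed input.

Nothing here says anything about the status of the Hodge conjecture for CM abelian varieties, which is NOT proved
(HC_CM is NOT proved by anyone in this repository).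
-/

set_option autoImplicit false

noncomputable section

namespace Summit.Ventures.HodgeRepro.Tier4.Line1.Rot

open Matrix

section Generic

variable {R : Type} [CommRing R]

/-- the block-scalar matrix `diag([[x, −d y], [y, x]], [[x′, −d y′], [y′, x′]])` (column picture: the first block
sends `e₀ ↦ x e₀ + y e₁`, `e₁ ↦ −d y e₀ + x e₁`, i.e. is multiplication by `x + y√−d` on the line `(e₀, e₁ = Om e₀)`) -/
def blockScalar (d x y x' y' : R) : Matrix (Fin 4) (Fin 4) R :=
  Matrix.of ![![x, -(d * y), 0, 0], ![y, x, 0, 0], ![0, 0, x', -(d * y')], ![0, 0, y', x']]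

/-- the projector `diag(1, 1, 0, 0)` onto the first line of the adapted basis -/
def projFirst (R : Type) [CommRing R] : Matrix (Fin 4) (Fin 4) R := Matrix.diagonal ![1, 1, 0, 0]

/-- the matrix `diag(J, J)` of `Om` on the adapted basis -/
def omegaJ (d : R) : Matrix (Fin 4) (Fin 4) R :=
  Matrix.of ![![0, -d, 0, 0], ![1, 0, 0, 0], ![0, 0, 0, -d], ![0, 0, 1, 0]]

/-- the block scalars multiply like pairs of elements of `R[√−d]` -/
theorem blockScalar_mul (d x y x' y' u t u' t' : R) :
    blockScalar d x y x' y' * blockScalar d u t u' t' =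
      blockScalar d (x * u - d * (y * t)) (x * t + y * u) (x' * u' - d * (y' * t'))
        (x' * t' + y' * u') := by
  ext i j
  fin_cases i <;> fin_cases j <;> simp [blockScalar, Matrix.mul_apply, Fin.sum_univ_four] <;> ring

/-- the block scalar of `(1, 0), (1, 0)` is the identity -/
theorem blockScalar_one (d : R) : blockScalar d 1 0 1 0 = 1 := by
  ext i j
  fin_cases i <;> fin_cases j <;> simp [blockScalar]

/-- a block scalar commutes with `diag(J, J)` -/
theorem blockScalar_comm_omegaJ (d x y x' y' : R) :
    blockScalar d x y x' y' * omegaJ d = omegaJ d * blockScalar d x y x' y' := by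
  ext i j
  fin_cases i <;> fin_cases j <;> simp [blockScalar, omegaJ, Matrix.mul_apply, Fin.sum_univ_four] <;> ring

/-- a block scalar commutes with `diag(1, 1, 0, 0)` -/
theorem blockScalar_comm_projFirst (d x y x' y' : R) :
    blockScalar d x y x' y' * projFirst R = projFirst R * blockScalar d x y x' y' := by
  ext i j
  fin_cases i <;> fin_cases j <;> simp [blockScalar, projFirst, Matrix.mul_diagonal, Matrix.diagonal_mul]

/-- a block scalar of norm-one blocks is an isometry of the Gram matrix `diag(α, dα, α′, dα′)` -/
theorem blockScalar_isometry (d x y x' y' α α' : R) (hxy : x * x + d * (y * y) = 1)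
    (hxy' : x' * x' + d * (y' * y') = 1) :
    (blockScalar d x y x' y')ᵀ * Matrix.diagonal ![α, d * α, α', d * α'] * blockScalar d x y x' y' =
      Matrix.diagonal ![α, d * α, α', d * α'] := by
  ext i j
  fin_cases i <;> fin_cases j <;>
    simp [blockScalar, Matrix.mul_apply, Fin.sum_univ_four, Matrix.diagonal, Matrix.transpose_apply] <;>
    first
    | ring1
    | linear_combination α * hxy
    | linear_combination (d * α) * hxy
    | linear_combination α' * hxy'
    | linear_combination (d * α') * hxy'

end Generic

section Torus

variable {k : Type} [Field k] [CharZero k] {R : Type} [CommRing R]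

/-- the adapted basis `(v, Om v, w, Om w)` of two orthogonal `E′`-lines, as the matrix with these COLUMNS -/
def adaptedBasis (Om : Matrix (Fin 4) (Fin 4) k) (v w : Fin 4 → k) : Matrix (Fin 4) (Fin 4) k :=
  Matrix.of fun i j => ![v, Om *ᵥ v, w, Om *ᵥ w] j i

/-- **the adapted-basis set-up over `R`** (t4-L1-p3's `stab_scalar_of_isometry` set-up, with attribution, plus the
projector): with `S = adaptedBasis Om v w` and `SR = S.map ι`, `SR′ = (S⁻¹).map ι`: `SR SR′ = 1 = SR′ SR`,
`Om = SR · diag(J, J) · SR′`-wise `Om SR = SR diag(J, J)`, `P SR = SR diag(1, 1, 0, 0)`, and the Gram matrix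
`SRᵀ B SR = diag(α, dα, α′, dα′)` with `α = β(v, v)`, `α′ = β(w, w)` non-zero, `d ≠ 0`. -/
theorem adapted_setup (ι : k →+* R) {B Om P : Matrix (Fin 4) (Fin 4) k} {d : k} (hB : Bᵀ = B)
    (hherm : Omᵀ * B = -(B * Om)) (hOm : Om * Om = -(d • (1 : Matrix (Fin 4) (Fin 4) k)))
    (hd : ¬ IsSquare (-d)) (hdef : ∀ u : Fin 4 → k, u ≠ 0 → u ⬝ᵥ (B *ᵥ u) ≠ 0)
    {v w : Fin 4 → k} (hv : v ≠ 0) (hw : w ≠ 0) (hwv : w ⬝ᵥ (B *ᵥ v) = 0)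
    (hwOv : w ⬝ᵥ (B *ᵥ (Om *ᵥ v)) = 0)
    (hPv : P *ᵥ v = v) (hPOv : P *ᵥ (Om *ᵥ v) = Om *ᵥ v) (hPw : P *ᵥ w = 0)
    (hPOw : P *ᵥ (Om *ᵥ w) = 0) :
    (adaptedBasis Om v w).map ι * ((adaptedBasis Om v w)⁻¹).map ι = 1 ∧
    ((adaptedBasis Om v w)⁻¹).map ι * (adaptedBasis Om v w).map ι = 1 ∧
    Om.map ι * (adaptedBasis Om v w).map ι = (adaptedBasis Om v w).map ι * omegaJ (ι d) ∧
    P.map ι * (adaptedBasis Om v w).map ι = (adaptedBasis Om v w).map ι * projFirst R ∧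
    ((adaptedBasis Om v w).map ι)ᵀ * B.map ι * (adaptedBasis Om v w).map ι =
      Matrix.diagonal ![ι (v ⬝ᵥ (B *ᵥ v)), ι d * ι (v ⬝ᵥ (B *ᵥ v)), ι (w ⬝ᵥ (B *ᵥ w)),
        ι d * ι (w ⬝ᵥ (B *ᵥ w))] ∧
    v ⬝ᵥ (B *ᵥ v) ≠ 0 ∧ w ⬝ᵥ (B *ᵥ w) ≠ 0 ∧ d ≠ 0 := by
  have hvw : v ⬝ᵥ (B *ᵥ w) = 0 := by rw [pair_comm hB]; exact hwv
  have hvOw : v ⬝ᵥ (B *ᵥ (Om *ᵥ w)) = 0 := by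
    rw [← neg_eq_zero, ← pair_mulVec_left hherm, pair_comm hB]
    exact hwOv
  set S : Matrix (Fin 4) (Fin 4) k := adaptedBasis Om v w with hSdef
  set α : k := v ⬝ᵥ (B *ᵥ v) with hαdef
  set α' : k := w ⬝ᵥ (B *ᵥ w) with hα'def
  have hG : Sᵀ * B * S = Matrix.diagonal ![α, d * α, α', d * α'] := gram_adapted hB hherm hOm v w hvw hvOw
  have hα : α ≠ 0 := hdef v hv
  have hα' : α' ≠ 0 := hdef w hw
  have hd0 : d ≠ 0 := by
    rintro rfl
    exact hd ⟨0, by simp⟩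
  have hGdet : (Matrix.diagonal ![α, d * α, α', d * α']).det ≠ 0 := by
    rw [Matrix.det_diagonal, Fin.prod_univ_four]
    simp only [Matrix.cons_val_zero, Matrix.cons_val_one, Matrix.head_cons, Matrix.cons_val_two,
      Matrix.cons_val_three, Matrix.tail_cons]
    exact mul_ne_zero (mul_ne_zero (mul_ne_zero hα (mul_ne_zero hd0 hα)) hα') (mul_ne_zero hd0 hα')
  have hSdet : IsUnit S.det := by
    rw [isUnit_iff_ne_zero]
    intro h0
    apply hGdet
    rw [← hG, Matrix.det_mul, Matrix.det_mul, Matrix.det_transpose, h0, zero_mul, zero_mul]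
  have hSS : S * S⁻¹ = 1 := Matrix.mul_nonsing_inv S hSdet
  have hSS' : S⁻¹ * S = 1 := Matrix.nonsing_inv_mul S hSdet
  have hOmS : Om * S = S * Matrix.of ![![0, -d, 0, 0], ![1, 0, 0, 0], ![0, 0, 0, -d], ![0, 0, 1, 0]] :=
    mul_adapted_eq hOm v w
  -- the projector on the adapted basis: `P S = S diag(1, 1, 0, 0)`
  have hPS : P * S = S * projFirst k := by
    ext i j
    fin_cases j
    · simpa [Matrix.mul_apply, Fin.sum_univ_four, S, adaptedBasis, projFirst, Matrix.diagonal,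
        Matrix.mulVec, dotProduct] using congrFun hPv i
    · simpa [Matrix.mul_apply, Fin.sum_univ_four, S, adaptedBasis, projFirst, Matrix.diagonal,
        Matrix.mulVec, dotProduct] using congrFun hPOv i
    · simpa [Matrix.mul_apply, Fin.sum_univ_four, S, adaptedBasis, projFirst, Matrix.diagonal,
        Matrix.mulVec, dotProduct] using congrFun hPw i
    · simpa [Matrix.mul_apply, Fin.sum_univ_four, S, adaptedBasis, projFirst, Matrix.diagonal,
        Matrix.mulVec, dotProduct] using congrFun hPOw i
  -- everything over `R`
  have hRR : S.map ι * (S⁻¹).map ι = 1 := by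
    rw [← Matrix.map_mul, hSS, Matrix.map_one _ (map_zero ι) (map_one ι)]
  have hRR' : (S⁻¹).map ι * S.map ι = 1 := by
    rw [← Matrix.map_mul, hSS', Matrix.map_one _ (map_zero ι) (map_one ι)]
  have hJmap : (Matrix.of ![![0, -d, 0, 0], ![1, 0, 0, 0], ![0, 0, 0, -d], ![0, 0, 1, 0]]).map ι =
      omegaJ (ι d) := by
    ext i j
    fin_cases i <;> fin_cases j <;> simp [omegaJ]
  have hGmap : (Matrix.diagonal ![α, d * α, α', d * α']).map ι =
      Matrix.diagonal ![ι α, ι d * ι α, ι α', ι d * ι α'] := by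
    ext i j
    rw [Matrix.map_apply, Matrix.diagonal_apply, Matrix.diagonal_apply]
    split_ifs with h
    · subst h
      fin_cases i <;> simp
    · simp
  have hDmap : (projFirst k).map ι = projFirst R := by
    ext i j
    rw [projFirst, projFirst, Matrix.map_apply, Matrix.diagonal_apply, Matrix.diagonal_apply]
    split_ifs with h
    · subst h
      fin_cases i <;> simp
    · simp
  refine ⟨hRR, hRR', ?_, ?_, ?_, hα, hα', hd0⟩
  · rw [← hJmap, ← Matrix.map_mul, ← Matrix.map_mul, hOmS]
  · rw [← hDmap, ← Matrix.map_mul, ← Matrix.map_mul, hPS]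
  · rw [← hGmap, ← hG, Matrix.map_mul, Matrix.map_mul, Matrix.transpose_map]

/-- **an `Om`-linear `B`-isometry commuting with the projector onto one of two orthogonal `E′`-lines is a pair of
norm-one scalars** (column picture, over any commutative `k`-algebra `R` through `ι`; the torus twin of
`stab_scalar_of_isometry`, whose set-up is `adapted_setup`): with `P v = v`, `P (Om v) = Om v`, `P w = 0`,
`P (Om w) = 0` and `M` commuting with `P`, `M = S · blockScalar d x y x′ y′ · S⁻¹` with `x² + d y² = 1 = x′² + d y′²`. -/
theorem torus_scalar_of_isometry (ι : k →+* R) {B Om P : Matrix (Fin 4) (Fin 4) k} {d : k} (hB : Bᵀ = B)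
    (hherm : Omᵀ * B = -(B * Om)) (hOm : Om * Om = -(d • (1 : Matrix (Fin 4) (Fin 4) k)))
    (hd : ¬ IsSquare (-d)) (hdef : ∀ u : Fin 4 → k, u ≠ 0 → u ⬝ᵥ (B *ᵥ u) ≠ 0)
    {v w : Fin 4 → k} (hv : v ≠ 0) (hw : w ≠ 0) (hwv : w ⬝ᵥ (B *ᵥ v) = 0)
    (hwOv : w ⬝ᵥ (B *ᵥ (Om *ᵥ v)) = 0)
    (hPv : P *ᵥ v = v) (hPOv : P *ᵥ (Om *ᵥ v) = Om *ᵥ v) (hPw : P *ᵥ w = 0)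
    (hPOw : P *ᵥ (Om *ᵥ w) = 0)
    {M : Matrix (Fin 4) (Fin 4) R}
    (hMOm : M * Om.map ι = Om.map ι * M) (hMB : Mᵀ * B.map ι * M = B.map ι)
    (hMP : M * P.map ι = P.map ι * M) :
    ∃ x y x' y' : R, x * x + ι d * (y * y) = 1 ∧ x' * x' + ι d * (y' * y') = 1 ∧
      M = (adaptedBasis Om v w).map ι * blockScalar (ι d) x y x' y' *
        ((adaptedBasis Om v w)⁻¹).map ι := by
  obtain ⟨hRR, hRR', hOmR, hPR, hGR', hα, hα', hd0⟩ :=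
    adapted_setup ι hB hherm hOm hd hdef hv hw hwv hwOv hPv hPOv hPw hPOw (R := R)
  set SR : Matrix (Fin 4) (Fin 4) R := (adaptedBasis Om v w).map ι with hSR
  set SR' : Matrix (Fin 4) (Fin 4) R := ((adaptedBasis Om v w)⁻¹).map ι with hSR'
  set JR : Matrix (Fin 4) (Fin 4) R := omegaJ (ι d) with hJR
  set GR : Matrix (Fin 4) (Fin 4) R := Matrix.diagonal ![ι (v ⬝ᵥ (B *ᵥ v)), ι d * ι (v ⬝ᵥ (B *ᵥ v)),
    ι (w ⬝ᵥ (B *ᵥ w)), ι d * ι (w ⬝ᵥ (B *ᵥ w))] with hGR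
  -- the conjugate `N`
  set N : Matrix (Fin 4) (Fin 4) R := SR' * M * SR with hNdef
  have hNJ : N * JR = JR * N := by
    have hOm' : Om.map ι = SR * JR * SR' := by
      rw [← hOmR, Matrix.mul_assoc, hRR, Matrix.mul_one]
    calc N * JR = SR' * (M * (SR * JR)) := by rw [hNdef]; simp only [Matrix.mul_assoc]
      _ = SR' * (M * (Om.map ι * SR)) := by rw [hOmR]
      _ = SR' * ((M * Om.map ι) * SR) := by rw [Matrix.mul_assoc]
      _ = SR' * ((Om.map ι * M) * SR) := by rw [hMOm]
      _ = (SR' * SR) * JR * (SR' * M * SR) := by rw [hOm']; simp only [Matrix.mul_assoc]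
      _ = JR * N := by rw [hRR', Matrix.one_mul, hNdef]
  have hND : N * projFirst R = projFirst R * N := by
    have hP' : P.map ι = SR * projFirst R * SR' := by
      rw [← hPR, Matrix.mul_assoc, hRR, Matrix.mul_one]
    calc N * projFirst R = SR' * (M * (SR * projFirst R)) := by rw [hNdef]; simp only [Matrix.mul_assoc]
      _ = SR' * (M * (P.map ι * SR)) := by rw [hPR]
      _ = SR' * ((M * P.map ι) * SR) := by rw [Matrix.mul_assoc]
      _ = SR' * ((P.map ι * M) * SR) := by rw [hMP]
      _ = (SR' * SR) * projFirst R * (SR' * M * SR) := by rw [hP']; simp only [Matrix.mul_assoc]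
      _ = projFirst R * N := by rw [hRR', Matrix.one_mul, hNdef]
  have hNG : Nᵀ * GR * N = GR := by
    have hB' : B.map ι = SR'ᵀ * GR * SR' := by
      rw [← hGR']
      calc B.map ι = (SR'ᵀ * SRᵀ) * B.map ι * (SR * SR') := by
            rw [← Matrix.transpose_mul, hRR, Matrix.transpose_one, Matrix.one_mul, Matrix.mul_one]
        _ = SR'ᵀ * (SRᵀ * B.map ι * SR) * SR' := by simp only [Matrix.mul_assoc]
    calc Nᵀ * GR * N = SRᵀ * Mᵀ * (SR'ᵀ * GR * SR') * M * SR := by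
          rw [hNdef, Matrix.transpose_mul, Matrix.transpose_mul]
          simp only [Matrix.mul_assoc]
      _ = SRᵀ * (Mᵀ * B.map ι * M) * SR := by rw [← hB']; simp only [Matrix.mul_assoc]
      _ = GR := by rw [hMB, hGR']
  -- entry extraction: block-diagonal
  have hα_u : IsUnit (ι (v ⬝ᵥ (B *ᵥ v))) := (isUnit_iff_ne_zero.mpr hα).map ι
  have hα'_u : IsUnit (ι (w ⬝ᵥ (B *ᵥ w))) := (isUnit_iff_ne_zero.mpr hα').map ι
  have hD : ∀ i j, (N * projFirst R) i j = (projFirst R * N) i j := fun i j => by rw [hND]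
  have d02 : N 0 2 = 0 := by
    have := hD 0 2; simp [projFirst, Matrix.mul_diagonal, Matrix.diagonal_mul] at this; exact this.symm
  have d03 : N 0 3 = 0 := by
    have := hD 0 3; simp [projFirst, Matrix.mul_diagonal, Matrix.diagonal_mul] at this; exact this.symm
  have d12 : N 1 2 = 0 := by
    have := hD 1 2; simp [projFirst, Matrix.mul_diagonal, Matrix.diagonal_mul] at this; exact this.symm
  have d13 : N 1 3 = 0 := by
    have := hD 1 3; simp [projFirst, Matrix.mul_diagonal, Matrix.diagonal_mul] at this; exact this.symm
  have d20 : N 2 0 = 0 := by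
    have := hD 2 0; simp [projFirst, Matrix.mul_diagonal, Matrix.diagonal_mul] at this; exact this
  have d21 : N 2 1 = 0 := by
    have := hD 2 1; simp [projFirst, Matrix.mul_diagonal, Matrix.diagonal_mul] at this; exact this
  have d30 : N 3 0 = 0 := by
    have := hD 3 0; simp [projFirst, Matrix.mul_diagonal, Matrix.diagonal_mul] at this; exact this
  have d31 : N 3 1 = 0 := by
    have := hD 3 1; simp [projFirst, Matrix.mul_diagonal, Matrix.diagonal_mul] at this; exact this
  -- entry extraction: the blocks commute with `J`
  have hJ : ∀ i j, (N * JR) i j = (JR * N) i j := fun i j => by rw [hNJ]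
  have j01 : N 0 1 = -(ι d * N 1 0) := by
    have := hJ 0 0; simp [Matrix.mul_apply, Fin.sum_univ_four, JR, omegaJ, d02, d03] at this; exact this
  have j11 : N 1 1 = N 0 0 := by
    have := hJ 1 0; simp [Matrix.mul_apply, Fin.sum_univ_four, JR, omegaJ, d12, d13] at this; exact this
  have j23 : N 2 3 = -(ι d * N 3 2) := by
    have := hJ 2 2; simp [Matrix.mul_apply, Fin.sum_univ_four, JR, omegaJ, d20, d21] at this; exact this
  have j33 : N 3 3 = N 2 2 := by
    have := hJ 3 2; simp [Matrix.mul_apply, Fin.sum_univ_four, JR, omegaJ, d30, d31] at this; exact this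
  -- entry extraction: the norms
  have hGe : ∀ i j, (Nᵀ * GR * N) i j = GR i j := fun i j => by rw [hNG]
  have g00 : N 0 0 * N 0 0 + ι d * (N 1 0 * N 1 0) = 1 := by
    have := hGe 0 0
    simp [Matrix.mul_apply, Fin.sum_univ_four, GR, Matrix.diagonal, d20, d30] at this
    have h2 : ι (v ⬝ᵥ (B *ᵥ v)) * (N 0 0 * N 0 0 + ι d * (N 1 0 * N 1 0)) =
        ι (v ⬝ᵥ (B *ᵥ v)) * 1 := by
      rw [mul_one]
      linear_combination this
    exact hα_u.mul_left_cancel h2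
  have g22 : N 2 2 * N 2 2 + ι d * (N 3 2 * N 3 2) = 1 := by
    have := hGe 2 2
    simp [Matrix.mul_apply, Fin.sum_univ_four, GR, Matrix.diagonal, d02, d12] at this
    have h2 : ι (w ⬝ᵥ (B *ᵥ w)) * (N 2 2 * N 2 2 + ι d * (N 3 2 * N 3 2)) =
        ι (w ⬝ᵥ (B *ᵥ w)) * 1 := by
      rw [mul_one]
      linear_combination this
    exact hα'_u.mul_left_cancel h2
  refine ⟨N 0 0, N 1 0, N 2 2, N 3 2, g00, g22, ?_⟩
  have hNblock : N = blockScalar (ι d) (N 0 0) (N 1 0) (N 2 2) (N 3 2) := by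
    ext i j
    fin_cases i <;> fin_cases j <;> simp [blockScalar, d02, d03, d12, d13, d20, d21, d30, d31, j01, j11, j23, j33]
  calc M = (SR * SR') * M * (SR * SR') := by rw [hRR, Matrix.one_mul, Matrix.mul_one]
    _ = SR * (SR' * M * SR) * SR' := by simp only [Matrix.mul_assoc]
    _ = SR * blockScalar (ι d) (N 0 0) (N 1 0) (N 2 2) (N 3 2) * SR' := by
        rw [← hNdef]
        exact congrArg (fun X => SR * X * SR') hNblock

/-- **the converse**: a block scalar with norm-one blocks, conjugated by the adapted basis, is an `Om`-linear
`B`-isometry commuting with the projector `P`. -/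
theorem isometry_of_blockScalar (ι : k →+* R) {B Om P : Matrix (Fin 4) (Fin 4) k} {d : k} (hB : Bᵀ = B)
    (hherm : Omᵀ * B = -(B * Om)) (hOm : Om * Om = -(d • (1 : Matrix (Fin 4) (Fin 4) k)))
    (hd : ¬ IsSquare (-d)) (hdef : ∀ u : Fin 4 → k, u ≠ 0 → u ⬝ᵥ (B *ᵥ u) ≠ 0)
    {v w : Fin 4 → k} (hv : v ≠ 0) (hw : w ≠ 0) (hwv : w ⬝ᵥ (B *ᵥ v) = 0)
    (hwOv : w ⬝ᵥ (B *ᵥ (Om *ᵥ v)) = 0)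
    (hPv : P *ᵥ v = v) (hPOv : P *ᵥ (Om *ᵥ v) = Om *ᵥ v) (hPw : P *ᵥ w = 0)
    (hPOw : P *ᵥ (Om *ᵥ w) = 0) (x y x' y' : R) (hxy : x * x + ι d * (y * y) = 1)
    (hxy' : x' * x' + ι d * (y' * y') = 1) :
    let M := (adaptedBasis Om v w).map ι * blockScalar (ι d) x y x' y' * ((adaptedBasis Om v w)⁻¹).map ι
    M * Om.map ι = Om.map ι * M ∧ Mᵀ * B.map ι * M = B.map ι ∧ M * P.map ι = P.map ι * M := by
  obtain ⟨hRR, hRR', hOmR, hPR, hGR', -, -, -⟩ :=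
    adapted_setup ι hB hherm hOm hd hdef hv hw hwv hwOv hPv hPOv hPw hPOw (R := R)
  set SR : Matrix (Fin 4) (Fin 4) R := (adaptedBasis Om v w).map ι with hSR
  set SR' : Matrix (Fin 4) (Fin 4) R := ((adaptedBasis Om v w)⁻¹).map ι with hSR'
  set bs : Matrix (Fin 4) (Fin 4) R := blockScalar (ι d) x y x' y' with hbs
  have hOm' : Om.map ι = SR * omegaJ (ι d) * SR' := by
    rw [← hOmR, Matrix.mul_assoc, hRR, Matrix.mul_one]
  have hP' : P.map ι = SR * projFirst R * SR' := by
    rw [← hPR, Matrix.mul_assoc, hRR, Matrix.mul_one]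
  have hB' : B.map ι = SR'ᵀ * Matrix.diagonal ![ι (v ⬝ᵥ (B *ᵥ v)), ι d * ι (v ⬝ᵥ (B *ᵥ v)),
      ι (w ⬝ᵥ (B *ᵥ w)), ι d * ι (w ⬝ᵥ (B *ᵥ w))] * SR' := by
    rw [← hGR']
    calc B.map ι = (SR'ᵀ * SRᵀ) * B.map ι * (SR * SR') := by
          rw [← Matrix.transpose_mul, hRR, Matrix.transpose_one, Matrix.one_mul, Matrix.mul_one]
      _ = SR'ᵀ * (SRᵀ * B.map ι * SR) * SR' := by simp only [Matrix.mul_assoc]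
  have h1 : SRᵀ * SR'ᵀ = 1 := by rw [← Matrix.transpose_mul, hRR', Matrix.transpose_one]
  refine ⟨?_, ?_, ?_⟩
  · calc SR * bs * SR' * Om.map ι = SR * bs * (SR' * SR) * omegaJ (ι d) * SR' := by
          rw [hOm']; simp only [Matrix.mul_assoc]
      _ = SR * (bs * omegaJ (ι d)) * SR' := by rw [hRR', Matrix.mul_one]; simp only [Matrix.mul_assoc]
      _ = SR * (omegaJ (ι d) * bs) * SR' := by rw [hbs, blockScalar_comm_omegaJ]
      _ = SR * omegaJ (ι d) * (SR' * SR) * bs * SR' := by rw [hRR', Matrix.mul_one]; simp only [Matrix.mul_assoc]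
      _ = Om.map ι * (SR * bs * SR') := by rw [hOm']; simp only [Matrix.mul_assoc]
  · calc (SR * bs * SR')ᵀ * B.map ι * (SR * bs * SR')
        = SR'ᵀ * bsᵀ * (SRᵀ * SR'ᵀ) * Matrix.diagonal ![ι (v ⬝ᵥ (B *ᵥ v)), ι d * ι (v ⬝ᵥ (B *ᵥ v)),
            ι (w ⬝ᵥ (B *ᵥ w)), ι d * ι (w ⬝ᵥ (B *ᵥ w))] * (SR' * SR) * bs * SR' := by
          rw [hB', Matrix.transpose_mul, Matrix.transpose_mul]; simp only [Matrix.mul_assoc]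
      _ = SR'ᵀ * (bsᵀ * Matrix.diagonal ![ι (v ⬝ᵥ (B *ᵥ v)), ι d * ι (v ⬝ᵥ (B *ᵥ v)),
            ι (w ⬝ᵥ (B *ᵥ w)), ι d * ι (w ⬝ᵥ (B *ᵥ w))] * bs) * SR' := by
          rw [h1, hRR', Matrix.mul_one, Matrix.mul_one]
          simp only [Matrix.mul_assoc]
      _ = B.map ι := by rw [hbs, blockScalar_isometry _ _ _ _ _ _ _ hxy hxy', hB']
  · calc SR * bs * SR' * P.map ι = SR * bs * (SR' * SR) * projFirst R * SR' := by
          rw [hP']; simp only [Matrix.mul_assoc]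
      _ = SR * (bs * projFirst R) * SR' := by rw [hRR', Matrix.mul_one]; simp only [Matrix.mul_assoc]
      _ = SR * (projFirst R * bs) * SR' := by rw [hbs, blockScalar_comm_projFirst]
      _ = SR * projFirst R * (SR' * SR) * bs * SR' := by rw [hRR', Matrix.mul_one]; simp only [Matrix.mul_assoc]
      _ = P.map ι * (SR * bs * SR') := by rw [hP']; simp only [Matrix.mul_assoc]

end Torus

end Summit.Ventures.HodgeRepro.Tier4.Line1.Rot

end
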